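/-
SKELETON for crux item stmt-PneNP-18538 (`StrongComposition`, C1) — line `lrb-gluing` (the rung C1|LRB), v3 (THIN).
Crux directory: Summits/PneNP/PneNP/Cruxes/StrongComposition/.  Line card: `Lines/lrb_gluing.md` (planner pnp-ideate-p4 g20).
v1 registered 2026-08-29T10:13Z (skeleton sha 950264758b84, 2 stubs); v2 (lead g1, crux write 53a4eb331237) CLOSED with the
proofs inline; v3 (lead g2) = v2 made THIN: every proof now lives under `Theorems/` and is IMPORTED —
`stub_jointSubspaceHard` = `KrwLrb.stub_jointSubspaceHard` (bench seat, p715652, `…LrbJointSubspaceHard.lean`, c = 3),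
`stub_lrbQuantitative` = `KrwLrb.stub_lrbQuantitative` (lead g1, p718845, `…LrbQuantitative.lean`, C = 1), the rung itself
= `KrwLrb.strongCompositionLRB` (p718994, `…LrbRung.lean`).  Sorry-free.  FRONTIER rung; nothing here bears on P vs NP.
-/
import Mathlib
import Summits.PneNP.PneNP.Theorems.KrwChromaticSteeringStrongCompositionLrbRung
import Summits.PneNP.PneNP.Theorems.KrwChromaticSteeringStrongCompositionLradRouteLink
import Literature.Computability.Complexity.KRWComposition

/-!
# Line `lrb-gluing`: the rung C1|LRB — skeleton v3 (THIN), CLOSED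

Target (registered with `--crux-decl`): `StrongCompositionLRB` — C1 (`Theses.KrwChromaticSteering.StrongComposition`)
verbatim, restricted to protocols that are `LRBDisciplined` (= `LRX_0`: node tests = label tests ∨ affine tests ∨
single-row tests; rows typed online with LOADS; an affine test never passes through a row already cut by a
single-row test, but a single-row test on an ALGEBRAIC row — type B — is allowed).  `LRAD ⊆ LRB` tree by tree, so this
rung contains the PROVED rung C1|LRAD (`KrwLrad.strongCompositionLRAD`), and is implied by C1 (`lrb_of_strongComposition`).

v3 (lead g2) = v2 with every proof REPLACED BY ITS LANDED MODULE: the class vocabulary (§1: `RowTypeX`, `affWeight`,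
`retagX`, `NodeOKX`, `LRXDisciplinedOn`, `LRXDisciplined`, `LRBDisciplined`) is the landed `Theorems.KrwLrb` copy
(`…LrbClassDefs.lean`, p717758; bodies byte-identical to v1/v2 §1); §2 (the rung and the stub statement) is VERBATIM v1/v2 over
that vocabulary, so the two registered stubs are closed BY NAME by the landed theorems (§3: definitional unfolding only); §4 the
composition (`assembly_of_quantitative`, `StrongCompositionLRB_of`) is VERBATIM v1 §3 / v2 §7 and kernel-checked here again; §5
`lrb_of_strongComposition` (C1 ⟹ rung) and the inclusion of the LRAD rung; §6 non-vacuity by the landed `KrwLrb.lrb_compose`.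

PROOF of `stub_lrbQuantitative` (landed, `…LrbTransfer.lean` p718396 + `…LrbQuantitative.lean` p718845; memo
`LensBarrierP4g20.md` §2): the glued LRAD invariant `KrwLrad.InvAt g q τ N` reused VERBATIM through `RowTypeX.proj`; induction
`KrwLrb.invAt_of_lrx` over `LRXDisciplinedOn g 0 τ N` by the landed LRAD step lemmas, the type-B node by `KrwLrb.transferB` (row
split of the common system with the COMMON internal parities of one solution, internal system moved into both row-sets, row game
`(q − λ_i)`-hard by `SubspaceHard`, `K ↦ min K k`); root `ℓ + q ≤ depth + 2` (`KrwLrb.lrb_rect_bound`), so `C = 1`.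
-/

set_option linter.dupNamespace false
set_option autoImplicit false

namespace Summit.PneNP.PneNP.Cruxes.StrongComposition.LrbGluing

open Literature.Computability.Complexity
open Summit.PneNP.PneNP.Theorems.KrwLrad
open Summit.PneNP.PneNP.Theorems.KrwLrb

/-! ## §1 The class LRB — IMPORTED (landed copy `Theorems.KrwLrb`, `…LrbClassDefs.lean` p717758, bodies byte-identical to
v1/v2 §1 = `P4g20X`): `RowTypeX`, `RowTypeX.load`, `affWeight`, `retagX`, `NodeOKX`, `LRXDisciplinedOn`, `LRXDisciplined`,
`LRBDisciplined`; support notions `SubspaceHard`, `jointSubspaceHard_exists` (`…LrbDefs.lean` p713896); LRAD vocabulary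
`Hard`, `parityOn`, `IsLabelTest`, `rowParity`, `AffGeneric`, `eqRows` (`Theorems.KrwLrad`, `…LradDefs.lean` p711344). -/

example : (LRBDisciplined : ((Fin 2 → Bool) → Bool) → KWTree (Fin 3 × Fin 2) → Prop)
    = fun g P => LRXDisciplined g 0 P := rfl

/-! ## §2 Target and the load-bearing stub STATEMENT (VERBATIM v1/v2) -/

/-- [verbatim `P4g20X.StrongCompositionLRB`] **the registered target: rung C1|LRB.** -/
def StrongCompositionLRB : Prop :=
  ∃ c : ℕ, ∀ m n : ℕ, 1 ≤ n → ∀ f : (Fin m → Bool) → Bool, (∃ a b, f a ≠ f b) →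
    ∃ g : (Fin n → Bool) → Bool, ∀ P : KWTree (Fin m × Fin n),
      LRBDisciplined g P → P.SolvesStrong f g →
      ∃ Q : KWTree (Fin m), Q.Solves f ∧ Q.depth + n ≤ P.depth + c * (Nat.log 2 (m * n) + 1)

/-- [verbatim `P4g20X.LRBQuantitative`] **the load-bearing stub statement.** -/
def LRBQuantitative : Prop :=
  ∃ C : ℕ, ∀ (m n q r ℓ : ℕ) (f : (Fin m → Bool) → Bool) (g : (Fin n → Bool) → Bool),
    (∃ a b, f a = true ∧ f b = false) →
    AffGeneric g r → q + r + 1 ≤ n → SubspaceHard g q → 1 ≤ q →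
    Hard (f ⁻¹' {true}) (f ⁻¹' {false}) ℓ →
    ∀ P : KWTree (Fin m × Fin n), LRBDisciplined g P → P.SolvesStrong f g →
      ℓ + (q - 1) ≤ P.depth + C

/-! ## §3 The two registered stubs — CLOSED BY NAME by the landed theorems (definitional unfolding only) -/

/-- **STUB 1 (support, S0⁺): joint existence by counting — PROVED** (bench seat, `KrwLrb.stub_jointSubspaceHard`,
`Theorems/KrwChromaticSteeringStrongCompositionLrbJointSubspaceHard.lean`, p715652, `c = 3`). -/
theorem stub_jointSubspaceHard : jointSubspaceHard_exists :=
  Summit.PneNP.PneNP.Theorems.KrwLrb.stub_jointSubspaceHard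

/-- **STUB 2 (load-bearing): the glued adversary bound on LRB — PROVED** (lead g1, `KrwLrb.stub_lrbQuantitative`,
`Theorems/KrwChromaticSteeringStrongCompositionLrbQuantitative.lean`, p718845, `C = 1`; this file's `LRBQuantitative` and the
landed `KrwLrb.LRBQuantitative` have byte-identical bodies over the same constants, so the landed theorem closes it by `δ`). -/
theorem stub_lrbQuantitative : LRBQuantitative :=
  Summit.PneNP.PneNP.Theorems.KrwLrb.stub_lrbQuantitative

/-! ## §4 Composition (kernel-checked, VERBATIM v1 §3 / v2 §7): the two stubs give the rung -/

section Assembly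

/-- **Assembly of the rung** from S0⁺ and the adversary bound ALONE, loss `(c + C + 2) (log₂ (m n) + 1)` where `c`
is the constant of S0⁺ and `C` the stub's additive constant.  Large `n` (`c (log₂ n + 1) + 2 ≤ n`, so the budget `q = n − r − 1 ≥ 1`, `r = c (log₂ n + 1)`):
S0⁺'s `g`, the bound in contrapositive form; tiny `n`: a dictator `g` and the `liftRows` embedding already fit. -/
theorem assembly_of_quantitative (h0 : jointSubspaceHard_exists) (hQ : LRBQuantitative) :
    ∃ c : ℕ, ∀ m n : ℕ, 1 ≤ n → ∀ f : (Fin m → Bool) → Bool, (∃ a b, f a ≠ f b) →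
      ∃ g : (Fin n → Bool) → Bool, ∀ P : KWTree (Fin m × Fin n),
        LRBDisciplined g P → P.SolvesStrong f g →
        ∃ Q : KWTree (Fin m), Q.Solves f ∧ Q.depth + n ≤ P.depth + c * (Nat.log 2 (m * n) + 1) := by
  obtain ⟨c, hc⟩ := h0
  obtain ⟨C, hQ⟩ := hQ
  refine ⟨c + C + 2, fun m n hn f hf => ?_⟩
  have hne : ∃ a b, f a = true ∧ f b = false := by
    obtain ⟨a, b, hab⟩ := hf
    cases ha : f a <;> cases hb : f b
    · rw [ha, hb] at hab; exact absurd rfl hab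
    · exact ⟨b, a, hb, ha⟩
    · exact ⟨a, b, ha, hb⟩
    · rw [ha, hb] at hab; exact absurd rfl hab
  have hm : 0 < m := by
    obtain ⟨a, b, hab⟩ := hf
    rcases Nat.eq_zero_or_pos m with h0 | h0
    · exfalso; subst h0; exact hab (congrArg f (funext fun i => i.elim0))
    · exact h0
  set L := Nat.log 2 (m * n) + 1 with hL
  have hLn : Nat.log 2 n + 1 ≤ L := by
    have : Nat.log 2 n ≤ Nat.log 2 (m * n) := Nat.log_mono_right (Nat.le_mul_of_pos_left n hm)
    omega
  set r := c * (Nat.log 2 n + 1) with hr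
  have hcL : r ≤ c * L := Nat.mul_le_mul_left _ hLn
  have hCL : C ≤ C * L := Nat.le_mul_of_pos_right C (by omega)
  have e1 : (c + C + 2) * L = c * L + C * L + 2 * L := by ring
  by_cases hbig : r + 2 ≤ n
  · -- large `n`: S0⁺'s inner function, budget `q = n - r - 1 ≥ 1`
    obtain ⟨g, hgen, hsub⟩ := hc n (by omega)
    refine ⟨g, fun P hP hsol => ?_⟩
    set q := n - r - 1 with hq
    have hq1 : 1 ≤ q := by omega
    have hqn : q + r + 1 ≤ n := by omega
    by_contra hcon
    push Not at hcon
    set ℓ := P.depth + (c + C + 2) * L + 1 - n with hℓ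
    have hH : Hard (f ⁻¹' {true}) (f ⁻¹' {false}) ℓ := by
      intro Q hQs
      have hs : Q.Solves f := fun a b ha hb => hQs a (by simpa using ha) b (by simpa using hb)
      have := hcon Q hs
      omega
    have hmain := hQ m n q r ℓ f g hne hgen hqn hsub hq1 hH P hP hsol
    omega
  · -- tiny `n` (`n ≤ r + 1 ≤ c L + 1`): a dictator and the `liftRows` protocol
    refine ⟨fun x => x ⟨0, by omega⟩, fun P hP hsol => ?_⟩
    refine ⟨P.comap (KWTree.liftRows (fun _ => true) (fun _ => false))
        (KWTree.liftRows (fun _ => true) (fun _ => false)) Prod.fst,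
      KWTree.solves_comap_liftRows hsol rfl rfl, ?_⟩
    rw [KWTree.depth_comap]
    omega

/-- **The skeleton's concluding theorem** (registrar shape: the ONLY theorem of this file whose result type is the
rung decl by name; it uses the two registered stubs by name; `assembly_of_quantitative` states the rung's body verbatim
so that it is not a second candidate).  Sorry-free. -/
theorem StrongCompositionLRB_of : StrongCompositionLRB :=
  assembly_of_quantitative stub_jointSubspaceHard stub_lrbQuantitative

end Assembly

/-! ## §5 C1 implies the rung; the rung contains the proved LRAD rung (landed `KrwLrb.strongCompositionLRAD_of_LRB`) -/

section Links

/-- C1 implies its LRB restriction (a refutation of the rung would refute C1; a proof is a rung). -/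
theorem lrb_of_strongComposition :
    Theses.KrwChromaticSteering.StrongComposition → StrongCompositionLRB := by
  rintro ⟨c, h⟩
  refine ⟨c, fun m n hn f hf => ?_⟩
  obtain ⟨g, hg⟩ := h m n hn f hf
  exact ⟨g, fun P _ hP => hg P hP⟩

/-- The rung of this file IS the landed `KrwLrb.StrongCompositionLRB` (byte-identical bodies over the same constants): the landed
theorem `KrwLrb.strongCompositionLRB` (p718994) closes it too (an `example`, so that `StrongCompositionLRB_of` stays the file's
only named witness of the registered decl). -/
example : StrongCompositionLRB :=
  Summit.PneNP.PneNP.Theorems.KrwLrb.strongCompositionLRB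

/-- The rung contains the PROVED rung C1|LRAD (`KrwLrad.StrongCompositionLRAD`, `…LradQuantitative.lean` p715960): every
LRAD-disciplined tree is LRB-disciplined (landed `KrwLrb.lrb_of_lrad`). -/
theorem strongCompositionLRAD_of_rung (h : StrongCompositionLRB) : StrongCompositionLRAD :=
  Summit.PneNP.PneNP.Theorems.KrwLrb.strongCompositionLRAD_of_LRB h

end Links

/-! ## §6 Non-vacuity (landed `KrwLrb.lrb_compose` / `KrwLrb.exists_lrb_solvesStrong`, `…LrbRung.lean` §3): independent play
`KWTree.compose g R Q` is LRB from every typing, so the rung is matched from above inside the class up to its `O(log mn)` loss. -/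

section NonVacuity

variable {m n : ℕ}

/-- **Independent play is LRB** (landed). -/
theorem lrb_compose (g : (Fin n → Bool) → Bool) (R : KWTree (Fin n)) (Q : KWTree (Fin m)) :
    LRBDisciplined g (KWTree.compose g R Q) :=
  Summit.PneNP.PneNP.Theorems.KrwLrb.lrb_compose g R Q

/-- From any `KW_f` protocol `Q` and `KW_g` protocol `R`, an LRB protocol for the strong game of depth
`Q.depth + R.depth + 1` (landed). -/
theorem exists_lrb_solvesStrong {f : (Fin m → Bool) → Bool} {g : (Fin n → Bool) → Bool}
    {Q : KWTree (Fin m)} {R : KWTree (Fin n)} (hQ : Q.Solves f) (hR : R.Solves g) :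
    ∃ P : KWTree (Fin m × Fin n), LRBDisciplined g P ∧ P.SolvesStrong f g ∧
      P.depth = Q.depth + R.depth + 1 :=
  Summit.PneNP.PneNP.Theorems.KrwLrb.exists_lrb_solvesStrong hQ hR

end NonVacuity

end Summit.PneNP.PneNP.Cruxes.StrongComposition.LrbGluing
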